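import Literature.AnabelianGeometry.EtaleTheta.Discharge.Sec3Thm37Cnst
import Literature.AnabelianGeometry.EtaleTheta.Discharge.Sec5UnitsCentralOfBiKummerData

/-!
# [EtTh] §5 at the GENUINE data: geometric automorphisms fix the units of `B_N` — the binder `hconst` of T56-L09b
# reduced to the constant-field vocabulary of Prop. 3.4 (ii) (PDF pp. 72–74, 103 = printed 298–300, 329)

Mochizuki, *The étale theta function and its Frobenioid-theoretic manifestations*, Publ. RIMS **45** (2009)
[cite: MochizukiEtTh2009, Prop 3.4 (ii) p.300 (PDF p.74); Thm 5.6 proof p.329 (PDF p.103)].  abc-iut cell, layer L2,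
GAP-LEDGER row **G-w5d020-1** («hconst»; sub-node T56-L09b of plan/L2/SUBDAG-EtTh-Thm56.md), seat abc-iut-w5-d020 gen 3
(the row's debtor lineage; the `cnst` vocabulary is abc-iut-L2-t3's `TemperedFrobenioidCnst.lean`, consumed read-only).
PROOF-ONLY (no definitions, no new named fact).

`hconst` (binder of `unitsCentralUnderLDelta_ofBiKummerData`, p419587; carried by p420099, p420788, p421022, p421202,
p424534): «for `δ` in the GEOMETRIC fundamental group `Ker(Π^tp_X ↠ G_K)` of the §2 data, the rational-function
component of every unit `τ ∈ O^×(B_N)` is fixed by `ρ_N(δ)`».  Print's reason (Thm. 5.6 proof p.329 l.19–21 «the Kummer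
class of the "constant function" `u` …»): the units of the tempered Frobenioid are CONSTANTS — Prop. 3.4 (ii), p.300
(PDF p.74): «natural isomorphisms `O_L^× ⥲ Ker(B₀(Y) → Φ₀^gp(Y))`, …, `L^× ⥲ F₀(Y)`», NATURAL in `Y` through
`D₀ → D^cnst` — and `D₀ → D^cnst` is «the natural functor determined by the natural surjection `Π^tp_X ↠ G_K`» (§3,
p.298 (PDF p.72)), under which geometric automorphisms become identities.  Typed:
* `TemperedFrobenioid.ratFnFunctor_map_unit_eq_of_cnst` — MODEL LEMMA over any tempered Frobenioid `C` (Def. 3.6 (ii))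
  satisfying abc-iut-L2-t3's `RealifiedDivisorMonoids.Prop34Cnst T cnst` for some constant-field functor
  `cnst : D₀ ⥤ D^cnst`, with `Φ` divisorial ([FrdI] Thm. 5.2 hypotheses): for `τ ∈ O^×(X)` the component `u_τ ∈ B(X^bs)`
  is `(b, Div τ) = (b, 0)` with `b ∈ F₀^Λ` CONSTANT (abc-iut-L2-t3's `unit_fst_mem_FΛ`, Sec3Thm37Cnst), hence fixed by every
  `g : X^bs → X^bs` of `D` whose image in `D^cnst` is the identity (`Prop34Cnst.BΛ_map_eq_of_cnst_map_eq`);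
* `ThetaFrobenioid.hconst_ofBiKummerData_of_cnst` — the EXACT binder `hconst` for abc-iut-L2-t4's assembled §5 data
  `ofBiKummerData …`, from `Prop34Cnst T₀ cnst` and the origin clause `hΔcnst` «`cnst` maps `ρ_N(δ)`, `δ ∈ Ker(aug)`, to
  the identity» (the §3 p.298 sentence, relating the §2 augmentation to the §3 constant-field functor; recorded as
  GAP-LEDGER G-w5d020-2 — it is what remains of G-w5d020-1);
* `unitsCentralUnderLDelta_ofBiKummerData_of_cnst`, `cyclotomeCentralUnderLDelta_ofBiKummerData_of_cnst` — T56-L09b /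
  P55-L02b at the data with `hconst` DISCHARGED (residual named inputs: `hσ`, `hgeom`, `Prop34Cnst`, `hΔcnst`).
HONEST FRAMING: kernel-checked implications between typed statements about the assembled §5 data; [EtTh] is refereed;
nothing asserts that such data exist for an actual curve; typed ≠ discharged; no side taken on [IUTchIII] Cor. 3.12.
-/

noncomputable section

namespace Literature.AnabelianGeometry.EtaleTheta

open CategoryTheory Opposite Literature.AlgebraicGeometry.Frobenioids

universe u₀ v₀ u₁ v₁ u v w

/-! ### Model lemma: in a tempered Frobenioid with Prop. 3.4 (ii) constants, units have constant components -/

namespace TemperedFrobenioid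

variable {D₀ : Type u₀} [Category.{v₀} D₀] {V : FrdIMonoidStub.{w}} {T : RealifiedDivisorMonoids (D₀ := D₀) V}
  {D : Type u} [Category.{v} D] {VD : FrdICatStub.{u, v, w} D} (C : TemperedFrobenioid T D VD)
  {Dcnst : Type u₁} [Category.{v₁} Dcnst] {cnst : D₀ ⥤ Dcnst}

/-- **The `B₀^Λ`-component of a unit is trivial-divisor** ([FrdI] Thm. 5.2 (ii): for `τ ∈ O^×(X)` the relation (d) reads
`Div(τ) = Div_B(u_τ)`, and `Div(τ) = 0` since `Φ(X^bs)` is divisorial, hence sharp; `Div_B` of the tempered Frobenioid is the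
second projection of `B = B₀^Λ ×_{(Φ^{ℝ-log})^gp} Φ^gp`, Def. 3.6 (ii) p.303 (PDF p.77)).
[cite: MochizukiEtTh2009, Def 3.6 (ii) p.303 (PDF p.77)] -/
theorem unit_snd_eq_one_of_mem_units (hΦd : Objectwise (fun M _ => IsDivisorial M) C.divisorMonoid) {X : C.category}
    {τ : Aut X} (hτ : τ ∈ ModelFrobenioid.units X) : (ModelFrobenioid.unit τ.hom).1.2 = 1 := by
  have hrel := ModelFrobenioid.of_div_eq_divB_unit_of_mem_units hτ
  rw [ModelFrobenioid.div_eq_one_of_mem_units (hΦd X.base).isSharp hτ, map_one] at hrel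
  exact hrel.symm

/-- A unit `τ ∈ O^×(X)` of the model tempered Frobenioid is a base-identity linear endomorphism (`τ ∈ O^▷(X)`, [FrdI]
Def. 1.2 (ii)) — so abc-iut-L2-t3's `unit_fst_mem_FΛ` (Prop. 3.4 (ii): the `B₀^Λ`-component of `u_f`, `f ∈ O^▷(X)`, is a
CONSTANT) applies to it.  [cite: MochizukiEtTh2009, Def 3.6 (ii) p.303 (PDF p.77)] -/
theorem hom_mem_endSubmonoid_of_mem_units {X : C.category} {τ : Aut X} (hτ : τ ∈ ModelFrobenioid.units X) :
    τ.hom ∈ PreFrobenioid.endSubmonoid C.toElem X :=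
  ⟨hτ.1, hτ.2⟩

/-- **Automorphisms of `X^bs` trivial in `D^cnst` fix the unit components** (Prop. 3.4 (ii), naturality of
`L^× ⥲ F₀(Y)` in `Y` through `D₀ → D^cnst`, p.300 (PDF p.74); abc-iut-L2-t3's `Prop34Cnst.BΛ_map_eq_of_cnst_map_eq`): for
`τ ∈ O^×(X)` and `g : X^bs → X^bs` with `cnst(g) = id`, the pull-back `B(g)(u_τ) = u_τ`.
[cite: MochizukiEtTh2009, Prop 3.4 (ii) p.300 (PDF p.74)] -/
theorem ratFnFunctor_map_unit_eq_of_cnst (hP34 : RealifiedDivisorMonoids.Prop34Cnst T cnst)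
    (hΦd : Objectwise (fun M _ => IsDivisorial M) C.divisorMonoid) {X : C.category} {τ : Aut X}
    (hτ : τ ∈ ModelFrobenioid.units X) (g : X.base ⟶ X.base)
    (hg : cnst.map (C.base.map g) = 𝟙 (cnst.obj (C.base.obj X.base))) :
    (C.ratFnFunctor.map g.op).hom (ModelFrobenioid.unit τ.hom) = ModelFrobenioid.unit τ.hom := by
  apply Subtype.ext
  change ((T.BΛ.map (C.base.map g).op).hom (ModelFrobenioid.unit τ.hom).1.1,
      gpMap (C.Φ.pull g.op) (ModelFrobenioid.unit τ.hom).1.2) = (ModelFrobenioid.unit τ.hom).1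
  apply Prod.ext
  · -- the constant component: naturality through `D^cnst`, compared with `g' := 𝟙`
    have hnat := hP34.BΛ_map_eq_of_cnst_map_eq (C.base.map g) (𝟙 _) (by rw [hg, cnst.map_id])
      (ModelFrobenioid.unit τ.hom).1.1 (C.unit_fst_mem_FΛ hP34 (C.hom_mem_endSubmonoid_of_mem_units hτ))
    change (T.BΛ.map (C.base.map g).op).hom (ModelFrobenioid.unit τ.hom).1.1 = (ModelFrobenioid.unit τ.hom).1.1
    rw [hnat, op_id, T.BΛ.map_id]
    rfl
  · -- the divisor component is trivial
    change gpMap (C.Φ.pull g.op) (ModelFrobenioid.unit τ.hom).1.2 = (ModelFrobenioid.unit τ.hom).1.2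
    rw [C.unit_snd_eq_one_of_mem_units hΦd hτ, map_one]

end TemperedFrobenioid

/-! ### `hconst` for `ThetaFrobenioid.ofBiKummerData` -/

namespace ThetaFrobenioid

open FrobenioidCyclotomicRigidity

variable {K : Type u₀} [Field K]
variable {X : SemiGraphs.TemperedArithmeticGroup.{u₀} K} {D₀ : Type u₀} [Category.{v₀} D₀]
  {V : FrdIMonoidStub.{w}} {T₀ : RealifiedDivisorMonoids (D₀ := D₀) V} {D : Type u} [Category.{v} D]
  {VD : FrdICatStub.{u, v, w} D} {S : BiKummerSetting X T₀ D VD}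
  {pullFrac : ∀ {A A' : S.C} (_ : A' ⟶ A), S.biratUnits A → S.biratUnits A'}
  {lv N : ℕ+} {T : ThetaEnvData.{max v w} N} {θ : S.biratUnits S.Aodot} {Bl : S.C}
  {Pl : S.FractionPair θ Bl} {Rl : S.NthRoot θ Pl lv pullFrac}
  (h : ModelFrobenioid.Hypotheses S.tf.divisorMonoid S.tf.ratFnFunctor)
  (toB : ∀ A : S.C, S.biratUnits A →* S.tf.biratUnitsModel A) (Q : FrobenioidTheta.ThetaSubquotientStub.{w} D)
  (odd_l : Odd (lv : ℕ)) (R : S.NthRoot Rl.root Rl.pair N pullFrac) (ιX : T.PiX ≃ₜ* X.Pi)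
  (hopen : IsOpen ((S.galoisSurj R.AN.base R.αData.isGalois).ker : Set X.Pi)) (σ : Aut R.AN.base →* Aut R.AN)
  (K' : Type w) [Field K'] (constEmb : K'ˣ →* S.tf.biratUnitsModel R.BN)
  (constEmb_injective : Function.Injective constEmb)
  (hdivc : ∀ g : Aut R.BN.base,
    ModelFrobenioid.div ((σ ((BiKummerSetting.NthRoot.baseIso S R).conjAut.symm g)).hom ≫ R.pair.num) =
      ModelFrobenioid.div R.pair.num)
  (hdivp : ∀ y : T.PiYdd,
    ModelFrobenioid.div ((σ (S.galoisSurj R.AN.base R.αData.isGalois (ιX y.1))).hom ≫ R.pair.den) =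
      ModelFrobenioid.div R.pair.den)
  {Dcnst : Type u₁} [Category.{v₁} Dcnst] {cnst : D₀ ⥤ Dcnst}

include h in
/-- **The binder `hconst` of T56-L09b DERIVED** (GAP-LEDGER G-w5d020-1): for the assembled §5 data over a §4 setting whose
realified divisor monoids satisfy Prop. 3.4 (ii) relative to a constant-field functor `cnst : D₀ → D^cnst`
(abc-iut-L2-t3's `Prop34Cnst`), geometric automorphisms `ρ_N(δ)`, `δ ∈ Ker(aug)` — which `cnst` sends to identities
(`hΔcnst`: «`D₀ → D^cnst` is determined by `Π^tp_X ↠ G_K`», §3 p.298 (PDF p.72)) — fix the rational-function component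
of every unit of `B_N` (the units are constants, p.329 (PDF p.103) l.19–21).
[cite: MochizukiEtTh2009, Prop 3.4 (ii) p.300 (PDF p.74); Thm 5.6 proof p.329 (PDF p.103)] -/
theorem hconst_ofBiKummerData_of_cnst (hP34 : RealifiedDivisorMonoids.Prop34Cnst T₀ cnst)
    (hΔcnst : ∀ δ ∈ T.aug.ker,
      cnst.map (S.tf.base.map (rhoOfBiKummerData R ιX δ).hom) = 𝟙 (cnst.obj (S.tf.base.obj R.BN.base))) :
    ∀ δ ∈ T.aug.ker, ∀ τ : ModelFrobenioid.units R.BN,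
      (S.tf.ratFnFunctor.map (rhoOfBiKummerData R ιX δ).hom.op).hom (ModelFrobenioid.unit τ.1.hom) =
        ModelFrobenioid.unit τ.1.hom :=
  fun δ hδ τ => S.tf.ratFnFunctor_map_unit_eq_of_cnst hP34 h.isDivisorial τ.2 _ (hΔcnst δ hδ)

/-- **EtTh:Thm5.6(i)/T56-L09b at the assembled §5 data with `hconst` DISCHARGED** — `Thm56Sub.UnitsCentralUnderLDelta
(ofBiKummerData …) P` (the lifts `s^⊓-gp_N(g)` of the part over `(l·Δ_Θ)_{B_N}` commute with `O^×(B_N)`, p.329 (PDF p.103)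
l.19–21) from this lineage's `unitsCentralUnderLDelta_ofBiKummerData` (p419587), modulo: the section property `hσ`
([FrdI] Prop. 5.6), `hgeom` (the part over `(l·Δ_Θ)_{B_N}` is geometric; MERGE-PLAN row 2), abc-iut-L2-t3's `Prop34Cnst`
(Prop. 3.4 (ii)) and the origin clause `hΔcnst` (§3 p.298 (PDF p.72)).
[cite: MochizukiEtTh2009, Thm 5.6 proof p.329 (PDF p.103)] -/
theorem unitsCentralUnderLDelta_ofBiKummerData_of_cnst
    (hσ : ∀ g : Aut R.AN.base, ModelFrobenioid.baseMap (σ g).hom = g.hom)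
    (P : ThetaSubquotientProj (ofBiKummerData h toB Q odd_l R ιX hopen σ K' constEmb constEmb_injective hdivc hdivp))
    (hgeom : P.pre R.BN.base ≤ T.aug.ker.map (rhoOfBiKummerData R ιX))
    (hP34 : RealifiedDivisorMonoids.Prop34Cnst T₀ cnst)
    (hΔcnst : ∀ δ ∈ T.aug.ker,
      cnst.map (S.tf.base.map (rhoOfBiKummerData R ιX δ).hom) = 𝟙 (cnst.obj (S.tf.base.obj R.BN.base))) :
    Thm56Sub.UnitsCentralUnderLDelta
      (ofBiKummerData h toB Q odd_l R ιX hopen σ K' constEmb constEmb_injective hdivc hdivp) P :=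
  unitsCentralUnderLDelta_ofBiKummerData h toB Q odd_l R ιX hopen σ K' constEmb constEmb_injective hdivc hdivp hσ P
    hgeom (hconst_ofBiKummerData_of_cnst h R ιX hP34 hΔcnst)

/-- **EtTh:Prop5.5/P55-L02b at the assembled §5 data with `hconst` DISCHARGED** — the lifts commute with `μ_N(B_N)`
(`Thm56Sub.CyclotomeCentralUnderLDelta`), by `Thm56Sub.cyclotomeCentral_of_unitsCentral`.
[cite: MochizukiEtTh2009, Prop 5.5 proof p.327 (PDF p.101)] -/
theorem cyclotomeCentralUnderLDelta_ofBiKummerData_of_cnst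
    (hσ : ∀ g : Aut R.AN.base, ModelFrobenioid.baseMap (σ g).hom = g.hom)
    (P : ThetaSubquotientProj (ofBiKummerData h toB Q odd_l R ιX hopen σ K' constEmb constEmb_injective hdivc hdivp))
    (hgeom : P.pre R.BN.base ≤ T.aug.ker.map (rhoOfBiKummerData R ιX))
    (hP34 : RealifiedDivisorMonoids.Prop34Cnst T₀ cnst)
    (hΔcnst : ∀ δ ∈ T.aug.ker,
      cnst.map (S.tf.base.map (rhoOfBiKummerData R ιX δ).hom) = 𝟙 (cnst.obj (S.tf.base.obj R.BN.base))) :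
    Thm56Sub.CyclotomeCentralUnderLDelta
      (ofBiKummerData h toB Q odd_l R ιX hopen σ K' constEmb constEmb_injective hdivc hdivp) P :=
  Thm56Sub.cyclotomeCentral_of_unitsCentral _
    (unitsCentralUnderLDelta_ofBiKummerData_of_cnst h toB Q odd_l R ιX hopen σ K' constEmb constEmb_injective hdivc hdivp
      hσ P hgeom hP34 hΔcnst)

end ThetaFrobenioid

end Literature.AnabelianGeometry.EtaleTheta

end
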